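import Summits.BirchSwinnertonDyer.BirchSwinnertonDyer.Theorems.GenusKolyvaginAtTwoK4NegPhantomFrameAlphaTwinMinimal
import Summits.BirchSwinnertonDyer.BirchSwinnertonDyer.Theorems.GenusKolyvaginAtTwoK4NegPhantomFrameEntangledIffTrace
import Summits.BirchSwinnertonDyer.BirchSwinnertonDyer.Theorems.ByReductionTypeAtTwoRankOneAtTwoOffBigImageOddLocalEngineDictionary
import HarnessLib

/-!
# Route `GenusKolyvaginAtTwo`, crux K₄⁻ `K4Neg` (stmt-BirchSwinnertonDyer-31526), LINE 34 phantom cell F4ᵖᵍ —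
# AT EVERY PRIME HEEGNER FRAME OF A `Δ < 0` CURVE THE FROBENIUS IS A TRANSPOSITION ON `E[2]`, so the trace bit applies to ALL frames

Width seat `bsd-line-gk2-p4` g34 (cell `bsd-f1-sign2`), WIDTH-5 attach on route `GenusKolyvaginAtTwo` rev 59; sequel of
`…K4NegPhantomFrameTraceBit` (p789093), `…EntangledIffTrace` (p789412), `…AlphaTwinMinimal` (p789671).
`--supports stmt-BirchSwinnertonDyer-31526 --as helper`.  THEOREMS ONLY (no definition, no named fact, no `sorry`); standard axioms.
**BSD is NOT proved by this file; `K4Neg` is NOT proved; no item is closed by it.**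

WHY.  The trace-bit theorems take an arithmetic Frobenius `γ` at `ℓ₀` acting on `E[2]` as an involution `≠ 1` (`hinv`, `hγT`); gk2-p3 g34's
supplied frames carry such a `γ` by construction (`Frob_{ℓ₀} = c₀` on `E[2]`), but `K4Neg` quantifies over EVERY prime Heegner frame
`K = ℚ(√−ℓ₀)`.  Here the two hypotheses are DISCHARGED from the frame data alone: by quadratic reciprocity
(`GenusKolyTwin.jacobiSym_minimalDiscriminantInt_eq_sign_of_discr_eq_neg_prime`: `(Δ_min | ℓ₀) = sign Δ = −1`) and the level-1 dictionary
(`OffBigImageOddLocalAtTwo.Engine.sign_permGal_eq_one_iff`: `sign(γ|E[2]) = (Δ_min / ℓ₀)`), EVERY arithmetic Frobenius at EVERY prime above `ℓ₀`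
is an ODD permutation of `E[2] ∖ 0`, i.e. a transposition: `γ² = 1 ≠ γ` on `E[2]`.

* §1 `frob_involution_of_prime_heegner_frame` — **`Δ < 0`, `K` imaginary quadratic with odd `d_K = −ℓ₀` (`ℓ₀` prime), Heegner for `N_W`;
  `γ` an arithmetic Frobenius at a prime above `ℓ₀` ⟹ `γ·γ` fixes `E[2]` pointwise and `γ` moves a point of `E[2]`.**
* §2 the trace bit AT EVERY FRAME (hypotheses = frame data + `ρ̄₂`, `ρ₄` onto + the Lawson–Wuthrich class):
  `h1Eval_frob_mul_frob_eq_zero_iff_four_dvd_of_prime_frame` (`[x, γ·γ] = 0 ⟺ 4 ∣ a_{ℓ₀}`),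
  `mem_torsionLocalKer_padic_iff_four_dvd_of_prime_frame` (`loc_{ℓ₀} x = 0 ⟺ 4 ∣ a_{ℓ₀}`),
  `forall_torsionFixing_four_smul_eq_iff_of_prime_frame` (twin ENTANGLED ⟺ Selmer-entangled ∧ `4 ∣ a_{ℓ₀}`),
  `natCard_selmerGroup_twin_eq_two_of_not_four_dvd_of_prime_frame` ((α) ⟹ `#Sel₂(Wd) = 2` on the Selmer-entangled K₄ cell).

READING (LINE 34; nothing closed).  With gk2-p3 g34's core and LEAD g28's `…PhantomCellHalvingBit`, the case split of a v1.6 composition at an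
ARBITRARY K₄⁻ frame is now available by name: obtain `γ` (`exists_isArithFrobAt_of_mem_primesAbove_holds`), then `4 ∣ a_{ℓ₀}` or not.
BSD is NOT proved by any of this.

References: [IrelandRosen1990] Prop. 5.1.2, 5.2.2; [SilvermanAEC2009] III.§1, VIII.8; [LawsonWuthrich2016] §3, §7.1; [MazurRubin2010] Cor. 3.4 (i).
-/

set_option linter.dupNamespace false -- `Summit.<P>.<Sub>` repeats `BirchSwinnertonDyer` (D-0017)
set_option autoImplicit false

noncomputable section

open scoped Classical Pointwise

namespace Summit.BirchSwinnertonDyer.BirchSwinnertonDyer.Theorems.GenusExact.PhantomDescentBit.TraceBit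

open WeierstrassCurve Field NumberField IsDedekindDomain
open Literature.NumberTheory.GaloisRepresentations Literature.NumberTheory.EllipticCurves
open Literature.NumberTheory
open Literature.NumberTheory.EllipticCurves.DokchitserDokchitser2012 (permGal T_permGal T_injective eq_zero_or_eq_T permGal_mul)
open Rat.HeightOneSpectrum (primesEquiv)
open Summit.BirchSwinnertonDyer.BirchSwinnertonDyer.Theorems.GenusKolyTwistingPrime

/-- In `S₃ = Perm(Fin 3)` an odd permutation is an involution. [folklore] -/
theorem perm_fin_three_mul_self_eq_one_of_sign_eq_neg_one :
    ∀ p : Equiv.Perm (Fin 3), Equiv.Perm.sign p = -1 → p * p = 1 := by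
  decide

variable (W : WeierstrassCurve ℚ) [W.IsElliptic] [W.IsGloballyMinimal] {K : Type} [Field K] [NumberField K]

/-- ★ **AT A PRIME HEEGNER FRAME OF A `Δ < 0` CURVE EVERY FROBENIUS IS A TRANSPOSITION ON `E[2]`.**  `W/ℚ` globally minimal with `Δ < 0`;
`K` imaginary quadratic with odd `d_K = −ℓ₀`, `ℓ₀` prime, satisfying the Heegner hypothesis for `N_W`; `v` the place of `ℓ₀`, `𝔓 ∣ v` a prime of
`\bar ℤ`, `γ` an arithmetic Frobenius at `𝔓`.  Then **`γ·γ` fixes every point of `E[2]` and `γ` moves some point of `E[2]`**: `(Δ_min | ℓ₀) = −1`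
(the unique transposition prime of `d_K`, `jacobiSym_minimalDiscriminantInt_eq_sign_of_discr_eq_neg_prime`) so `γ|E[2]` is an odd permutation of
the three non-zero points (`sign_permGal_eq_one_iff`), i.e. a transposition. [cite: IrelandRosen1990, Prop. 5.1.2, Prop. 5.2.2]
[cite: SilvermanAEC2009, III.§1, VIII.8] -/
theorem frob_involution_of_prime_heegner_frame (hΔ : W.Δ < 0) (hK : IsImaginaryQuadratic K) (hodd : Odd (discr K))
    (hH : SatisfiesHeegnerHypothesis (W.conductorNorm ℤ) K) {ℓ : ℕ} [Fact ℓ.Prime] (hd : discr K = -(ℓ : ℤ))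
    {v : HeightOneSpectrum (𝓞 ℚ)} (hℓv : (ℓ : 𝓞 ℚ) ∈ v.asIdeal) {𝔓 : Ideal (absIntegers (𝓞 ℚ) ℚ)} (h𝔓 : 𝔓 ∈ v.primesAbove)
    {γ : absoluteGaloisGroup ℚ} (hγ : IsArithFrobAt (𝓞 ℚ) γ 𝔓) :
    (∀ T : geomTorsion W (2 : ℤ), γ • γ • T = T) ∧ ∃ T : geomTorsion W (2 : ℤ), γ • T ≠ T := by
  have hℓ : ℓ.Prime := Fact.out
  obtain ⟨hℓ2, -, hℓΔ⟩ := GenusKolyTwin.prime_discr_facts W hK hodd hH hℓ hd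
  have hv : (primesEquiv v : ℕ) = ℓ := primesEquiv_eq hℓ hℓv
  -- `(Δ_min | ℓ₀) = −1`, so `Δ_min` is not a square mod `ℓ₀`
  have hjac := GenusKolyTwin.jacobiSym_minimalDiscriminantInt_eq_sign_of_discr_eq_neg_prime W hK hodd hH hd
  have hsign : (minimalDiscriminantInt W).sign = -1 := by
    rw [Int.sign_eq_neg_one_iff_neg]
    have h : (minimalDiscriminantInt W : ℚ) < 0 := by rw [cast_minimalDiscriminantInt]; exact hΔ
    exact_mod_cast h
  have hleg : legendreSym ℓ (minimalDiscriminantInt W) = -1 := by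
    rw [jacobiSym.legendreSym.to_jacobiSym, hjac, hsign]
  have hnsq : ¬ IsSquare ((minimalDiscriminantInt W : ℤ) : ZMod ℓ) := (legendreSym.eq_neg_one_iff ℓ).mp hleg
  -- `γ|E[2]` is an odd permutation, hence a transposition
  have hsgn : Equiv.Perm.sign (permGal W two_ne_zero γ) = -1 := by
    rcases Int.units_eq_one_or (Equiv.Perm.sign (permGal W two_ne_zero γ)) with h1 | h1
    · exact absurd ((OffBigImageOddLocalAtTwo.Engine.sign_permGal_eq_one_iff hℓ hℓ2 hℓΔ hv h𝔓 hγ).mp h1) hnsq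
    · exact h1
  have hsq : permGal W two_ne_zero (γ * γ) = 1 := by
    rw [permGal_mul]
    exact perm_fin_three_mul_self_eq_one_of_sign_eq_neg_one _ hsgn
  refine ⟨fun T ↦ ?_, ?_⟩
  · rw [← mul_smul]
    rcases eq_zero_or_eq_T W two_ne_zero T with rfl | ⟨i, rfl⟩
    · exact smul_zero _
    · rw [← T_permGal, hsq, Equiv.Perm.coe_one, id]
  · by_contra hall
    push Not at hall
    have h1 : permGal W two_ne_zero γ = 1 := by
      refine Equiv.ext fun i ↦ T_injective W two_ne_zero ?_
      rw [T_permGal, hall, Equiv.Perm.coe_one, id]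
    rw [h1, Equiv.Perm.sign_one] at hsgn
    exact absurd hsgn (by decide)

/-! ## §2 The trace bit at EVERY prime Heegner frame (hypotheses = frame data) -/

/-- ★★ **THE TRACE BIT AT AN ARBITRARY PRIME HEEGNER FRAME.**  `W/ℚ` globally minimal, `Δ < 0`, `ρ̄_{W,2}` and `ρ_{W,4}` onto, `x ≠ 0` in
`H¹(ℚ, E[2])` dying on `Γ_{ℚ(E[4])}`; `K` imaginary quadratic with odd `d_K = −ℓ₀` (prime), Heegner; `γ` ANY arithmetic Frobenius at a prime above
`ℓ₀`.  Then `γ·γ ∈ Γ_{ℚ(E[2])}` and **`[x, γ·γ] = 0 ⟺ 4 ∣ a_{ℓ₀}(W)`**. [cite: LawsonWuthrich2016, §3, §7.1] [cite: SilvermanAEC2009, Thm. V.2.3.1] -/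
theorem h1Eval_frob_mul_frob_eq_zero_iff_four_dvd_of_prime_frame
    (hsurj : W.HasSurjectiveModNGaloisRep 2) (hsurj4 : W.HasSurjectiveModNGaloisRep 4) (hΔ : W.Δ < 0)
    {x : galH1Torsion W (2 : ℤ)} (hx0 : x ≠ 0) (hx : ∀ h ∈ torsionFixing W (4 : ℤ), h1Eval W (2 : ℤ) x h = 0)
    (hK : IsImaginaryQuadratic K) (hodd : Odd (discr K)) (hH : SatisfiesHeegnerHypothesis (W.conductorNorm ℤ) K)
    {ℓ : ℕ} [Fact ℓ.Prime] (hd : discr K = -(ℓ : ℤ))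
    {v : HeightOneSpectrum (𝓞 ℚ)} (hℓv : (ℓ : 𝓞 ℚ) ∈ v.asIdeal) {𝔓 : Ideal (absIntegers (𝓞 ℚ) ℚ)} (h𝔓 : 𝔓 ∈ v.primesAbove)
    {γ : absoluteGaloisGroup ℚ} (hγ : IsArithFrobAt (𝓞 ℚ) γ 𝔓) :
    γ * γ ∈ torsionFixing W (2 : ℤ) ∧ (h1Eval W (2 : ℤ) x (γ * γ) = 0 ↔ (4 : ℤ) ∣ W.frobeniusTrace ℓ) := by
  have hℓ : ℓ.Prime := Fact.out
  obtain ⟨hℓ2, hℓN, -⟩ := GenusKolyTwin.prime_discr_facts W hK hodd hH hℓ hd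
  have hv : (primesEquiv v : ℕ) = ℓ := primesEquiv_eq hℓ hℓv
  have hW : W.HasGoodReductionAt v := by
    by_contra h
    exact hℓN (hv ▸ (W.dvd_conductorNorm_iff v).mpr h)
  obtain ⟨hinv, hγT⟩ := frob_involution_of_prime_heegner_frame W hΔ hK hodd hH hd hℓv h𝔓 hγ
  have hne : ((primesEquiv v : Nat.Primes) : ℕ) ≠ 2 := by rw [hv]; exact hℓ2
  have h := h1Eval_frob_mul_frob_eq_zero_iff_four_dvd_frobeniusTrace W hsurj hsurj4 hx0 hx hne hW ⟨𝔓, h𝔓, hγ⟩ hinv hγT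
  rw [hv] at h
  exact h

/-- ★★ **THE LOCAL TRACE BIT AT AN ARBITRARY PRIME HEEGNER FRAME: `loc_{ℓ₀} x = 0 ⟺ 4 ∣ a_{ℓ₀}`.**  Same data (no hypothesis on `γ` beyond
being a Frobenius at `ℓ₀`). [cite: GrossLMS1991, §9 Prop. 9.6] [cite: LawsonWuthrich2016, §7.1] -/
theorem mem_torsionLocalKer_padic_iff_four_dvd_of_prime_frame
    (hsurj : W.HasSurjectiveModNGaloisRep 2) (hsurj4 : W.HasSurjectiveModNGaloisRep 4) (hΔ : W.Δ < 0)
    {x : galH1Torsion W (2 : ℤ)} (hx0 : x ≠ 0) (hx : ∀ h ∈ torsionFixing W (4 : ℤ), h1Eval W (2 : ℤ) x h = 0)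
    (hK : IsImaginaryQuadratic K) (hodd : Odd (discr K)) (hH : SatisfiesHeegnerHypothesis (W.conductorNorm ℤ) K)
    {ℓ : ℕ} [Fact ℓ.Prime] (hd : discr K = -(ℓ : ℤ))
    {v : HeightOneSpectrum (𝓞 ℚ)} (hℓv : (ℓ : 𝓞 ℚ) ∈ v.asIdeal) {𝔓 : Ideal (absIntegers (𝓞 ℚ) ℚ)} (h𝔓 : 𝔓 ∈ v.primesAbove)
    {γ : absoluteGaloisGroup ℚ} (hγ : IsArithFrobAt (𝓞 ℚ) γ 𝔓) :
    x ∈ W.torsionLocalKer ℚ_[ℓ] (2 : ℤ) ↔ (4 : ℤ) ∣ W.frobeniusTrace ℓ := by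
  have hℓ : ℓ.Prime := Fact.out
  obtain ⟨hℓ2, hℓN, -⟩ := GenusKolyTwin.prime_discr_facts W hK hodd hH hℓ hd
  have hW : W.HasGoodReductionAt v := by
    by_contra h
    exact hℓN ((primesEquiv_eq hℓ hℓv) ▸ (W.dvd_conductorNorm_iff v).mpr h)
  obtain ⟨hinv, hγT⟩ := frob_involution_of_prime_heegner_frame W hΔ hK hodd hH hd hℓv h𝔓 hγ
  exact mem_torsionLocalKer_padic_iff_four_dvd_frobeniusTrace W hsurj hsurj4 hx0 hx hℓ2 hℓv hW h𝔓 hγ hinv hγT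

/-- ★★★ **ENTANGLED ⟺ SELMER-ENTANGLED ∧ `4 ∣ a_{ℓ₀}`, AT AN ARBITRARY PRIME HEEGNER FRAME** (p789412's criterion with `hinv`, `hγT`
discharged).  The (β)-frames of the LEAD road (`hHalf` fails) are exactly these. [cite: MazurRubin2010, Def. 3.1, Prop. 3.3] [cite: LawsonWuthrich2016, §3] -/
theorem forall_torsionFixing_four_smul_eq_iff_of_prime_frame
    (hsurj : W.HasSurjectiveModNGaloisRep 2) (hsurj4 : W.HasSurjectiveModNGaloisRep 4)
    (hΔ : W.Δ < 0) (hK : IsImaginaryQuadratic K) (hodd : Odd (discr K))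
    (hH : SatisfiesHeegnerHypothesis (W.conductorNorm ℤ) K) (h2K : ((Ideal.span {(2 : ℤ)}).primesOver (𝓞 K)).ncard = 2)
    {ℓ : ℕ} [Fact ℓ.Prime] (hd : discr K = -(ℓ : ℤ)) {Wd : WeierstrassCurve ℚ} [Wd.IsElliptic] {C : VariableChange ℚ}
    (hWd : C • W.quadraticTwist (discr K : ℚ) = Wd) (h2 : Nat.card (Wd.selmerGroup 2) = 2)
    (P : Wd.toAffine.Point) (Q : geomPoints Wd) (hQ : (2 : ℤ) • Q = toGeomPoints Wd P)
    (hP : ∀ T ∈ geomTorsion Wd (2 : ℤ), Q - T ∉ MulAction.fixedPoints (absoluteGaloisGroup ℚ) (geomPoints Wd))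
    {v : HeightOneSpectrum (𝓞 ℚ)} (hℓv : (ℓ : 𝓞 ℚ) ∈ v.asIdeal) {𝔓 : Ideal (absIntegers (𝓞 ℚ) ℚ)}
    (h𝔓 : 𝔓 ∈ v.primesAbove) {γ : absoluteGaloisGroup ℚ} (hγ : IsArithFrobAt (𝓞 ℚ) γ 𝔓) :
    (∀ h ∈ torsionFixing W (4 : ℤ), h • Q = Q) ↔
      (∃ y ∈ W.selmerGroup 2, y ≠ 0 ∧ ∀ h ∈ torsionFixing W (4 : ℤ), h1Eval W (2 : ℤ) y h = 0) ∧
        (4 : ℤ) ∣ W.frobeniusTrace ℓ := by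
  obtain ⟨hinv, hγT⟩ := frob_involution_of_prime_heegner_frame W hΔ hK hodd hH hd hℓv h𝔓 hγ
  exact forall_torsionFixing_four_smul_eq_iff_selmer_dying_and_four_dvd W hsurj hsurj4 hΔ hK hodd hH h2K hd hWd h2 P Q hQ hP hℓv
    h𝔓 hγ hinv hγT

/-- ★ **(α) ⟹ `Sel₂`-MINIMAL TWIN, AT AN ARBITRARY PRIME HEEGNER FRAME** of a Selmer-entangled K₄ curve (p789671 with `hinv`, `hγT` discharged).
[cite: MazurRubin2010, Cor. 3.4 (i), Prop. 3.3] [cite: LawsonWuthrich2016, §3] -/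
theorem natCard_selmerGroup_twin_eq_two_of_not_four_dvd_of_prime_frame
    (hsurj : W.HasSurjectiveModNGaloisRep 2) (hsurj4 : W.HasSurjectiveModNGaloisRep 4) (hΔ : W.Δ < 0)
    (h4W : Nat.card (W.selmerGroup 2) = 4)
    {x : galH1Torsion W (2 : ℤ)} (hxS : x ∈ W.selmerGroup 2) (hx0 : x ≠ 0)
    (hx : ∀ h ∈ torsionFixing W (4 : ℤ), h1Eval W (2 : ℤ) x h = 0)
    (hK : IsImaginaryQuadratic K) (hodd : Odd (discr K)) (hH : SatisfiesHeegnerHypothesis (W.conductorNorm ℤ) K)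
    (h2K : ((Ideal.span {(2 : ℤ)}).primesOver (𝓞 K)).ncard = 2)
    {ℓ : ℕ} [Fact ℓ.Prime] (hd : discr K = -(ℓ : ℤ)) (Wd : WeierstrassCurve ℚ) [Wd.IsElliptic]
    (hWd : ∃ C : VariableChange ℚ, C • W.quadraticTwist (discr K : ℚ) = Wd)
    {v : HeightOneSpectrum (𝓞 ℚ)} (hℓv : (ℓ : 𝓞 ℚ) ∈ v.asIdeal) {𝔓 : Ideal (absIntegers (𝓞 ℚ) ℚ)}
    (h𝔓 : 𝔓 ∈ v.primesAbove) {γ : absoluteGaloisGroup ℚ} (hγ : IsArithFrobAt (𝓞 ℚ) γ 𝔓)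
    (h4 : ¬ (4 : ℤ) ∣ W.frobeniusTrace ℓ) :
    Nat.card (Wd.selmerGroup 2) = 2 := by
  obtain ⟨hinv, hγT⟩ := frob_involution_of_prime_heegner_frame W hΔ hK hodd hH hd hℓv h𝔓 hγ
  exact natCard_selmerGroup_twin_eq_two_of_selmer_dying_of_not_four_dvd W hsurj hsurj4 hΔ h4W hxS hx0 hx hK hodd hH h2K hd Wd hWd hℓv
    h𝔓 hγ hinv hγT h4

end Summit.BirchSwinnertonDyer.BirchSwinnertonDyer.Theorems.GenusExact.PhantomDescentBit.TraceBit

end
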